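import Mathlib
import Summits.Ventures.PercRepro2.CutSideMasses
import Summits.Ventures.PercRepro2.CutLeafRow
import Summits.Ventures.PercRepro2.LeafAA0

/-!
# Row (LEAF-½) across a cut vertex separating `{a₁, b, v}` from `{a₂, o}`: (AA0) holds
(blind cell PercRepro2, p5 g28; `proofs/P5-OEDGE.md` §36)

Let `z` be a cut vertex with `a₁, b, v ∈ VA` and `a₂, o ∈ VB` (placement `ABA` of `(b, o, v)`;
`CutLeafRow.lean` treats `ABB`, `CutLeafRowAAB.lean` treats `AAB`, each with its root mirror).
Under `Q = {a₁ ↮ a₂}`: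

* the event `{v ∈ C₂} ∩ {o ∈ C₁}` forces `a₁ ↔ z` in `A` and `z ↔ a₂` in `B`, i.e. `a₁ ↔ a₂` — so
  it has no `Q`-mass (`mass_vHoL_ABA`, `mass_vHoLbL_ABA`) and the `(A)`-term collapses to the
  product `crossA = P(Q, o ∈ C₁)·anticov(vH, bL)` (`crossA_eq`), nonnegative by BHK06 Thm 1.4
  under `Q` (`anticov_nonneg_of_cross'`);
* the mirror term factorises over the two sides (`crossA'_eq`):
  `crossA′ = [P_B(a₂ ↔ o, a₂ ↔ z) − P_B(a₂ ↔ o)·P_B(a₂ ↔ z)] · [P(Q)·P_A(a₁ ↔ v, b ↔ z, a₁ ↮ z)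
   + P_B(a₂ ↔ z)·P_A(b ↔ z, a₁ ↮ z)·(P_A(a₁ ↔ v, a₁ ↔ z) − P_A(a₁ ↔ v)·P_A(a₁ ↔ z))]`,
  a product of a Harris slack on the `B`-side with a sum of products of masses and a Harris slack
  on the `A`-side (`crossA'_nonneg_of_cut`). Probabilistically: given the `B`-side, the `A`-side
  law is one of TWO positively associated laws (unconditioned on `{z ↮ a₂}`, conditioned on
  `a₁ ↮ z` on `{z ↔ a₂}`), and the `(A′)`-term is `Cov_Q(H_o, 1{z ↔ a₂})` times a nonnegative
  `A`-side factor.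

Hence `0 ≤ crossAA` (`crossAA_nonneg_of_cut`) and row (LEAF-½) holds (`LeafRow_of_cut_ABA`, by
`LeafAA0.LeafRow_of_AA0`); `LeafRow_of_cut_ABA'` is the root mirror (`b, v` with `a₂`, `o` with
`a₁`). With `CutLeafRow` and `CutLeafRowAAB` this covers six of the eight placements of `(b, o, v)`
across a cut vertex; the two remaining ones (`AAA` and its mirror `BBB`) contain every graph (attach
`a₂` as a pendant of probability one), so no cut-vertex argument applies to them. Nothing here is
claimed off the class.
-/

namespace Summit.Ventures.PercRepro2

open UnionCluster CovForm PendantRoot LeafStep LeafHalfCross CutLeafRow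

namespace CutLeafRowABA

variable {V : Type*} {E : Type*} [Fintype E] [DecidableEq E] [Fintype V] [DecidableEq V]
  {R : Type*} [Field R] [LinearOrder R] [IsStrictOrderedRing R]

variable (p : E → R) (ends : E → Sym2 V) {z : V} {VA VB : Set V} {EA EB : Set E}
  [DecidablePred (· ∈ EA)] [DecidablePred (· ∈ EB)]

/-! ## The masses of the `(A)`-term: `{v ∈ C₂} ∩ {o ∈ C₁}` has no `Q`-mass -/

omit [Fintype V] [DecidableEq V] [LinearOrder R] [IsStrictOrderedRing R] in
/-- `P(Q, vH, oL) = 0` with `v ∈ VA`, `o ∈ VB`. -/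
lemma mass_vHoL_ABA (h : CutV.IsCut ends z VA VB EA EB) {a₁ a₂ o v : V} (ha₁ : a₁ ∈ VA)
    (hv : v ∈ VA) (ha₂ : a₂ ∈ VB) (ho : o ∈ VB) :
    prob p (avoidAll ends a₂ {a₁} ∩ (connEvent ends a₂ v ∩ connEvent ends a₁ o)) = 0 :=
  mass_zero p ends h ha₁ ha₂ (connEvent ends v z) (connEvent ends o z) (by
    ext ω
    simp only [Set.mem_inter_iff, CutV.mem_sideEvent]
    rw [memBA h ha₂ hv ω, memAB h ha₁ ho ω]
    tauto)

omit [Fintype V] [DecidableEq V] [LinearOrder R] [IsStrictOrderedRing R] in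
/-- `P(Q, vH, oL, bL) = 0` with `v, b ∈ VA`, `o ∈ VB`. -/
lemma mass_vHoLbL_ABA (h : CutV.IsCut ends z VA VB EA EB) {a₁ a₂ b o v : V} (ha₁ : a₁ ∈ VA)
    (hb : b ∈ VA) (hv : v ∈ VA) (ha₂ : a₂ ∈ VB) (ho : o ∈ VB) :
    prob p (avoidAll ends a₂ {a₁} ∩
      (connEvent ends a₂ v ∩ (connEvent ends a₁ o ∩ connEvent ends a₁ b))) = 0 :=
  mass_zero p ends h ha₁ ha₂ (connEvent ends v z ∩ connEvent ends a₁ b) (connEvent ends o z) (by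
    ext ω
    simp only [Set.mem_inter_iff, CutV.mem_sideEvent]
    rw [memBA h ha₂ hv ω, memAB h ha₁ ho ω, memA h ha₁ hb ω]
    tauto)

omit [Fintype V] [DecidableEq V] [LinearOrder R] [IsStrictOrderedRing R] in
/-- **The `(A)`-term is a product**: `crossA = P(Q, oL)·anticov(vH, bL)`. -/
theorem crossA_eq (h : CutV.IsCut ends z VA VB EA EB) {a₁ a₂ b o v : V} (ha₁ : a₁ ∈ VA)
    (hb : b ∈ VA) (hv : v ∈ VA) (ha₂ : a₂ ∈ VB) (ho : o ∈ VB) :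
    crossA p ends o a₁ a₂ v b =
      prob p (avoidAll ends a₂ {a₁} ∩ connEvent ends a₁ o) *
        anticov p ends a₁ a₂ (connEvent ends a₂ v) (connEvent ends a₁ b) := by
  unfold crossA
  rw [mass_vHoLbL_ABA p ends h ha₁ hb hv ha₂ ho, mass_vHoL_ABA p ends h ha₁ hv ha₂ ho]
  ring

/-- **`0 ≤ crossA` across a cut vertex separating `{a₁, b, v}` from `{a₂, o}`** (BHK06 Thm 1.4
under `Q` for the pair `(v ∈ C₂, b ∈ C₁)`). -/
theorem crossA_nonneg_of_cut (hp : IsProbVec p) (h : CutV.IsCut ends z VA VB EA EB)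
    {a₁ a₂ b o v : V} (ha₁ : a₁ ∈ VA) (hb : b ∈ VA) (hv : v ∈ VA) (ha₂ : a₂ ∈ VB) (ho : o ∈ VB) :
    0 ≤ crossA p ends o a₁ a₂ v b := by
  rw [crossA_eq p ends h ha₁ hb hv ha₂ ho]
  exact mul_nonneg (prob_nonneg hp _) (anticov_nonneg_of_cross' p ends hp a₁ a₂ v b)

/-! ## The masses of the mirror term -/

omit [Fintype V] [DecidableEq V] [LinearOrder R] [IsStrictOrderedRing R] in
/-- `P(Q, vL, oH, bH) = [P_A(a₁↔v, b↔z) − P_A(a₁↔v, b↔z, a₁↔z)]·P_B(a₂↔o, a₂↔z)`. -/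
lemma mass_vLoHbH_ABA (h : CutV.IsCut ends z VA VB EA EB) {a₁ a₂ b o v : V} (ha₁ : a₁ ∈ VA)
    (hb : b ∈ VA) (hv : v ∈ VA) (ha₂ : a₂ ∈ VB) (ho : o ∈ VB) :
    prob p (avoidAll ends a₂ {a₁} ∩
        (connEvent ends a₁ v ∩ (connEvent ends a₂ o ∩ connEvent ends a₂ b))) =
      (prob p (CutV.sideEvent EA (connEvent ends a₁ v ∩ connEvent ends b z)) -
          prob p (CutV.sideEvent EA (connEvent ends a₁ v ∩ connEvent ends b z ∩
            connEvent ends a₁ z))) *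
        prob p (CutV.sideEvent EB (connEvent ends a₂ o ∩ connEvent ends a₂ z)) := by
  have key := mass_of_sides p ends h ha₁ ha₂
    (X := connEvent ends a₁ v ∩ (connEvent ends a₂ o ∩ connEvent ends a₂ b))
    (connEvent ends a₁ v ∩ connEvent ends b z) (connEvent ends a₂ o ∩ connEvent ends a₂ z) (by
    ext ω
    simp only [Set.mem_inter_iff, CutV.mem_sideEvent]
    rw [memA h ha₁ hv ω, memB h ha₂ ho ω, memBA h ha₂ hb ω]
    tauto)
  rw [key, Set.inter_assoc (connEvent ends a₂ o), Set.inter_self]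
  ring

omit [Fintype V] [DecidableEq V] [LinearOrder R] [IsStrictOrderedRing R] in
/-- `P(Q, vL, oH) = P_A(a₁↔v)·P_B(a₂↔o) − P_A(a₁↔v, a₁↔z)·P_B(a₂↔o, a₂↔z)`. -/
lemma mass_vLoH_ABA (h : CutV.IsCut ends z VA VB EA EB) {a₁ a₂ o v : V} (ha₁ : a₁ ∈ VA)
    (hv : v ∈ VA) (ha₂ : a₂ ∈ VB) (ho : o ∈ VB) :
    prob p (avoidAll ends a₂ {a₁} ∩ (connEvent ends a₁ v ∩ connEvent ends a₂ o)) =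
      prob p (CutV.sideEvent EA (connEvent ends a₁ v)) *
          prob p (CutV.sideEvent EB (connEvent ends a₂ o)) -
        prob p (CutV.sideEvent EA (connEvent ends a₁ v ∩ connEvent ends a₁ z)) *
          prob p (CutV.sideEvent EB (connEvent ends a₂ o ∩ connEvent ends a₂ z)) :=
  mass_of_sides p ends h ha₁ ha₂ (X := connEvent ends a₁ v ∩ connEvent ends a₂ o)
    (connEvent ends a₁ v) (connEvent ends a₂ o) (by
    ext ω
    simp only [Set.mem_inter_iff, CutV.mem_sideEvent]
    rw [memA h ha₁ hv ω, memB h ha₂ ho ω])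

omit [Fintype V] [DecidableEq V] [LinearOrder R] [IsStrictOrderedRing R] in
/-- `P(Q, vL, bH) = [P_A(a₁↔v, b↔z) − P_A(a₁↔v, b↔z, a₁↔z)]·P_B(a₂↔z)`. -/
lemma mass_vLbH_ABA (h : CutV.IsCut ends z VA VB EA EB) {a₁ a₂ b v : V} (ha₁ : a₁ ∈ VA)
    (hb : b ∈ VA) (hv : v ∈ VA) (ha₂ : a₂ ∈ VB) :
    prob p (avoidAll ends a₂ {a₁} ∩ (connEvent ends a₁ v ∩ connEvent ends a₂ b)) =
      (prob p (CutV.sideEvent EA (connEvent ends a₁ v ∩ connEvent ends b z)) -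
          prob p (CutV.sideEvent EA (connEvent ends a₁ v ∩ connEvent ends b z ∩
            connEvent ends a₁ z))) *
        prob p (CutV.sideEvent EB (connEvent ends a₂ z)) := by
  have key := mass_of_sides p ends h ha₁ ha₂
    (X := connEvent ends a₁ v ∩ connEvent ends a₂ b)
    (connEvent ends a₁ v ∩ connEvent ends b z) (connEvent ends a₂ z) (by
    ext ω
    simp only [Set.mem_inter_iff, CutV.mem_sideEvent]
    rw [memA h ha₁ hv ω, memBA h ha₂ hb ω]
    tauto)
  rw [key, Set.inter_self]
  ring

omit [Fintype V] [DecidableEq V] [LinearOrder R] [IsStrictOrderedRing R] in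
/-- **The mirror term factorises over the two sides**:
`crossA′ = [P_B(a₂↔o, a₂↔z) − P_B(a₂↔o)·P_B(a₂↔z)] · [P(Q)·P_A(a₁↔v, b↔z, a₁↮z)
 + P_B(a₂↔z)·P_A(b↔z, a₁↮z)·(P_A(a₁↔v, a₁↔z) − P_A(a₁↔v)·P_A(a₁↔z))]`. -/
theorem crossA'_eq (h : CutV.IsCut ends z VA VB EA EB) {a₁ a₂ b o v : V} (ha₁ : a₁ ∈ VA)
    (hb : b ∈ VA) (hv : v ∈ VA) (ha₂ : a₂ ∈ VB) (ho : o ∈ VB) :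
    crossA p ends o a₂ a₁ v b =
      (prob p (CutV.sideEvent EB (connEvent ends a₂ o ∩ connEvent ends a₂ z)) -
          prob p (CutV.sideEvent EB (connEvent ends a₂ o)) *
            prob p (CutV.sideEvent EB (connEvent ends a₂ z))) *
        ((1 - prob p (CutV.sideEvent EA (connEvent ends a₁ z)) *
              prob p (CutV.sideEvent EB (connEvent ends a₂ z))) *
            (prob p (CutV.sideEvent EA (connEvent ends a₁ v ∩ connEvent ends b z)) -
              prob p (CutV.sideEvent EA (connEvent ends a₁ v ∩ connEvent ends b z ∩
                connEvent ends a₁ z))) +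
          prob p (CutV.sideEvent EB (connEvent ends a₂ z)) *
            (prob p (CutV.sideEvent EA (connEvent ends b z)) -
              prob p (CutV.sideEvent EA (connEvent ends b z ∩ connEvent ends a₁ z))) *
            (prob p (CutV.sideEvent EA (connEvent ends a₁ v ∩ connEvent ends a₁ z)) -
              prob p (CutV.sideEvent EA (connEvent ends a₁ v)) *
                prob p (CutV.sideEvent EA (connEvent ends a₁ z)))) := by
  unfold crossA anticov
  simp only [avoidAll_root_swap ends a₁ a₂]
  rw [mass_Q p ends h ha₁ ha₂, mass_vLoHbH_ABA p ends h ha₁ hb hv ha₂ ho,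
    mass_bH p ends h ha₁ hb ha₂, mass_vLoH_ABA p ends h ha₁ hv ha₂ ho, mass_oH p ends h ha₁ ha₂ ho,
    mass_bL p ends h ha₁ hv ha₂, mass_vLbH_ABA p ends h ha₁ hb hv ha₂]
  ring

/-! ## The signs -/

section Signs

variable (F : Set E) [DecidablePred (· ∈ F)]

omit [Fintype V] [DecidableEq V] in
/-- **Harris on a side**: `P_F(u ↔ w)·P_F(u′ ↔ w′) ≤ P_F(u ↔ w, u′ ↔ w′)`. -/
lemma side_harris (hp : IsProbVec p) (u w u' w' : V) :
    prob p (CutV.sideEvent F (connEvent ends u w)) *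
        prob p (CutV.sideEvent F (connEvent ends u' w')) ≤
      prob p (CutV.sideEvent F (connEvent ends u w ∩ connEvent ends u' w')) := by
  rw [side_eq, side_eq, side_eq]
  exact prob_mul_prob_le_prob_inter (CDCutVertex.isProbVec_zeroOff hp F)
    (isUpperSet_connEvent ends u w) (isUpperSet_connEvent ends u' w')

end Signs

omit [Fintype V] [DecidableEq V] in
/-- **`0 ≤ crossA′` across a cut vertex separating `{a₁, b, v}` from `{a₂, o}`.** -/
theorem crossA'_nonneg_of_cut (hp : IsProbVec p) (h : CutV.IsCut ends z VA VB EA EB)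
    {a₁ a₂ b o v : V} (ha₁ : a₁ ∈ VA) (hb : b ∈ VA) (hv : v ∈ VA) (ha₂ : a₂ ∈ VB) (ho : o ∈ VB) :
    0 ≤ crossA p ends o a₂ a₁ v b := by
  rw [crossA'_eq p ends h ha₁ hb hv ha₂ ho]
  have hB := side_harris p ends EB hp a₂ o a₂ z
  have hA := side_harris p ends EA hp a₁ v a₁ z
  have hα1 := prob_le_one hp (CutV.sideEvent EA (connEvent ends a₁ z))
  have hα0 := prob_nonneg hp (CutV.sideEvent EA (connEvent ends a₁ z))
  have hγ0 := prob_nonneg hp (CutV.sideEvent EB (connEvent ends a₂ z))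
  have hγ1 := prob_le_one hp (CutV.sideEvent EB (connEvent ends a₂ z))
  have hw : 0 ≤ prob p (CutV.sideEvent EA (connEvent ends a₁ v ∩ connEvent ends b z)) -
      prob p (CutV.sideEvent EA (connEvent ends a₁ v ∩ connEvent ends b z ∩
        connEvent ends a₁ z)) := by
    have := side_mono p EA hp
      (X := connEvent ends a₁ v ∩ connEvent ends b z ∩ connEvent ends a₁ z)
      (Y := connEvent ends a₁ v ∩ connEvent ends b z) Set.inter_subset_left
    linarith
  have hy : 0 ≤ prob p (CutV.sideEvent EA (connEvent ends b z)) -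
      prob p (CutV.sideEvent EA (connEvent ends b z ∩ connEvent ends a₁ z)) := by
    have := side_mono p EA hp (X := connEvent ends b z ∩ connEvent ends a₁ z)
      (Y := connEvent ends b z) Set.inter_subset_left
    linarith
  have hQ : 0 ≤ 1 - prob p (CutV.sideEvent EA (connEvent ends a₁ z)) *
      prob p (CutV.sideEvent EB (connEvent ends a₂ z)) := by nlinarith
  exact mul_nonneg (by linarith)
    (add_nonneg (mul_nonneg hQ hw) (mul_nonneg (mul_nonneg hγ0 hy) (by linarith)))

/-! ## The theorem -/

/-- **`0 ≤ crossAA` across a cut vertex separating `{a₁, b, v}` from `{a₂, o}`** — (AA0) on the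
class. -/
theorem crossAA_nonneg_of_cut (hp : IsProbVec p) (h : CutV.IsCut ends z VA VB EA EB)
    {a₁ a₂ b o v : V} (ha₁ : a₁ ∈ VA) (hb : b ∈ VA) (hv : v ∈ VA) (ha₂ : a₂ ∈ VB) (ho : o ∈ VB) :
    0 ≤ crossAA p ends o a₁ a₂ v b :=
  add_nonneg (crossA_nonneg_of_cut p ends hp h ha₁ hb hv ha₂ ho)
    (crossA'_nonneg_of_cut p ends hp h ha₁ hb hv ha₂ ho)

/-- **Row (LEAF-½) across a cut vertex separating `{a₁, b, v}` from `{a₂, o}`.** -/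
theorem LeafRow_of_cut_ABA (hp : IsProbVec p) (h : CutV.IsCut ends z VA VB EA EB)
    {a₁ a₂ b o v : V} (ha₁ : a₁ ∈ VA) (hb : b ∈ VA) (hv : v ∈ VA) (ha₂ : a₂ ∈ VB) (ho : o ∈ VB) :
    LeafRow p ends o a₁ a₂ v b :=
  LeafRow_of_AA0 p ends hp o a₁ a₂ v b (crossAA_nonneg_of_cut p ends hp h ha₁ hb hv ha₂ ho)

/-- **The root mirror**: a cut vertex `z` separating `{a₂, b, v}` from `{a₁, o}` also gives the row. -/
theorem LeafRow_of_cut_ABA' (hp : IsProbVec p) (h : CutV.IsCut ends z VA VB EA EB)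
    {a₁ a₂ b o v : V} (ha₂ : a₂ ∈ VA) (hb : b ∈ VA) (hv : v ∈ VA) (ha₁ : a₁ ∈ VB) (ho : o ∈ VB) :
    LeafRow p ends o a₁ a₂ v b :=
  (LeafRow_root_swap p ends o a₁ a₂ v b).1 (LeafRow_of_cut_ABA p ends hp h ha₂ hb hv ha₁ ho)

end CutLeafRowABA

end Summit.Ventures.PercRepro2
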